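import Summits.NavierStokesRegularity.NavierStokesRegularity.Theorems.DssFarFieldSlavingBlowupTypeIDssProfileSimilarityEnstrophyIBP
import HarnessLib

/-!
# Route `EfficiencyFloor`, crux `MaximiserSetRigidity` (stmt-NavierStokesRegularity-25512), part (b):
# tools for the enstrophy balance (EB) of relative-equilibrium profiles

Helper file (`--supports stmt-NavierStokesRegularity-25512`), used by `…MaximiserSetRigidityProfileEnstrophyBalance`
(the proof of (EB): the profile's vorticity equation tested against cut-offs `χ_R ω`, `R → ∞`). Contents, on
`ℝ³` with the tree's cut-offs `cutoff R` (`WholeSpaceIBP`):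

* `integrable_cutoff_mul` — `χ_R · f ∈ L¹` for continuous `f`;
* `inner_skew_self`, `isDivFree_skew`, `isDivFree_const` — a skew-adjoint `W` has `⟪Wv,v⟫ = 0` and the linear
  field `x ↦ Wx` is divergence free (`tr W = 0`); constants are divergence free;
* three truncation limits complementing `SimilarityEnstrophyIBP`:
  `tendsto_integral_fderiv_cutoff_apply_mul_of_integrable` (`∫(Dχ_R V)|w|² → 0` when `|V||w|² ∈ L¹`),
  `tendsto_integral_fderiv_cutoff_apply_mul_of_linearGrowth` (the same for a wind of linear growth
  `‖V x‖ ≤ M‖x‖`, e.g. the rotation wind `Wx`, using `|Dχ_R(x)(V x)| ≤ 2cM` on the shell `R ≤ ‖x‖ ≤ 2R` — the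
  flux `|w|² V` need not be integrable), `tendsto_integral_norm_sq_mul_laplacian_cutoff` (`∫|w|²Δχ_R → 0`,
  `|Δχ_R| ≤ C/R²`).

HONEST FRAMING: calculus tools only; nothing here bears on stmt-25512, `ProductionEfficiencyDecay` or
Navier–Stokes regularity. References: Evans 2010 App. C.2; Majda–Bertozzi 2002 §1.2. [folklore]
-/

noncomputable section

-- the problem directory repeats the summit name (`NavierStokesRegularity/NavierStokesRegularity`)
set_option linter.dupNamespace false

namespace Summit.NavierStokesRegularity.NavierStokesRegularity.Theorems

namespace MaximiserSetRigidity

namespace ProfileEnstrophyBalance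

open MeasureTheory Set Filter Topology Module InnerProductSpace
open scoped RealInnerProductSpace Laplacian ContDiff
open Literature.Analysis Literature.Analysis.FluidPDE
open Summit.NavierStokesRegularity.NavierStokesRegularity.Theorems.SimilarityEnstrophy
  (tendsto_integral_zero_of_norm_le_mul)

/-! ### Small tools -/

/-- A cut-off times a continuous function is integrable. [folklore] -/
theorem integrable_cutoff_mul {f : (EuclideanSpace ℝ (Fin 3)) → ℝ} (hf : Continuous f) {R : ℝ} (hR : 0 < R) :
    Integrable (fun x => cutoff R x * f x) :=
  ((contDiff_cutoff (n := 0) R).continuous.mul hf).integrable_of_hasCompactSupport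
    ((hasCompactSupport_cutoff hR).mul_right)

/-- A skew-adjoint map has `⟪W v, v⟫ = 0`. [folklore] -/
theorem inner_skew_self {W : (EuclideanSpace ℝ (Fin 3)) →L[ℝ] (EuclideanSpace ℝ (Fin 3))} (hW : ∀ x y : (EuclideanSpace ℝ (Fin 3)), ⟪W x, y⟫ = -⟪x, W y⟫) (v : (EuclideanSpace ℝ (Fin 3))) :
    ⟪W v, v⟫ = 0 := by
  have h1 := hW v v
  have h2 := real_inner_comm (W v) v
  linarith

/-- A skew-adjoint linear field `x ↦ W x` is divergence free (`div = tr W = 0`). [folklore] -/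
theorem isDivFree_skew {W : (EuclideanSpace ℝ (Fin 3)) →L[ℝ] (EuclideanSpace ℝ (Fin 3))} (hW : ∀ x y : (EuclideanSpace ℝ (Fin 3)), ⟪W x, y⟫ = -⟪x, W y⟫) :
    VectorCalculus.IsDivFree (⇑W : (EuclideanSpace ℝ (Fin 3)) → (EuclideanSpace ℝ (Fin 3))) := by
  intro x
  unfold VectorCalculus.divergence
  rw [W.fderiv, LinearMap.trace_eq_sum_inner _ (stdOrthonormalBasis ℝ (EuclideanSpace ℝ (Fin 3)))]
  refine Finset.sum_eq_zero fun i _ => ?_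
  rw [ContinuousLinearMap.coe_coe]
  have h1 := inner_skew_self hW (stdOrthonormalBasis ℝ (EuclideanSpace ℝ (Fin 3)) i)
  have h2 := real_inner_comm (W (stdOrthonormalBasis ℝ (EuclideanSpace ℝ (Fin 3)) i)) (stdOrthonormalBasis ℝ (EuclideanSpace ℝ (Fin 3)) i)
  linarith

/-- A constant field is divergence free. [folklore] -/
theorem isDivFree_const (a : (EuclideanSpace ℝ (Fin 3))) : VectorCalculus.IsDivFree (fun _ : (EuclideanSpace ℝ (Fin 3)) => a) := by
  intro x
  unfold VectorCalculus.divergence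
  rw [fderiv_fun_const]
  simp

/-! ### Three truncation limits -/

/-- `∫ (Dχ_{n+1}(x) (V x)) |w(x)|² dx → 0` when `‖V‖·|w|² ∈ L¹` (`‖Dχ_R‖ ≤ c/R`). [folklore] -/
theorem tendsto_integral_fderiv_cutoff_apply_mul_of_integrable {w V : (EuclideanSpace ℝ (Fin 3)) → (EuclideanSpace ℝ (Fin 3))}
    (hI : Integrable fun x => ‖V x‖ * ‖w x‖ ^ 2) :
    Tendsto (fun n : ℕ => ∫ x, fderiv ℝ (cutoff ((n : ℝ) + 1)) x (V x) * ‖w x‖ ^ 2) atTop (𝓝 0) := by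
  obtain ⟨c, hc0, hc⟩ := exists_norm_fderiv_cutoff_le (E := (EuclideanSpace ℝ (Fin 3)))
  refine tendsto_integral_zero_of_norm_le_mul hI (ε := fun n => c / ((n : ℝ) + 1)) ?_ ?_
  · exact tendsto_const_nhds.div_atTop (tendsto_natCast_atTop_atTop.atTop_add tendsto_const_nhds)
  · intro n x
    rw [norm_mul, norm_pow, norm_norm,
      Real.norm_of_nonneg (mul_nonneg (norm_nonneg (V x)) (sq_nonneg ‖w x‖))]
    calc ‖fderiv ℝ (cutoff ((n : ℝ) + 1)) x (V x)‖ * ‖w x‖ ^ 2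
        ≤ (‖fderiv ℝ (cutoff ((n : ℝ) + 1)) x‖ * ‖V x‖) * ‖w x‖ ^ 2 := by
          gcongr; exact ContinuousLinearMap.le_opNorm _ _
      _ ≤ (c / ((n : ℝ) + 1) * ‖V x‖) * ‖w x‖ ^ 2 := by
          gcongr; exact hc _ (by positivity) x
      _ = c / ((n : ℝ) + 1) * (‖V x‖ * ‖w x‖ ^ 2) := by ring

/-- `∫ (Dχ_{n+1}(x) (V x)) |w(x)|² dx → 0` when `|w|² ∈ L¹` and `V` has linear growth `‖V x‖ ≤ M‖x‖`
(e.g. the rotation wind `x ↦ W x`): on the shell `R ≤ ‖x‖ ≤ 2R` one has `|Dχ_R(x)(V x)| ≤ 2cM`, and the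
integrand vanishes for `‖x‖ < R` (dominated convergence). [folklore] -/
theorem tendsto_integral_fderiv_cutoff_apply_mul_of_linearGrowth {w V : (EuclideanSpace ℝ (Fin 3)) → (EuclideanSpace ℝ (Fin 3))} (hw : Continuous w)
    (hw2 : Integrable fun x => ‖w x‖ ^ 2) (hV : Continuous V) {M : ℝ} (hVb : ∀ x, ‖V x‖ ≤ M * ‖x‖) :
    Tendsto (fun n : ℕ => ∫ x, fderiv ℝ (cutoff ((n : ℝ) + 1)) x (V x) * ‖w x‖ ^ 2) atTop (𝓝 0) := by
  obtain ⟨c, hc0, hc⟩ := exists_norm_fderiv_cutoff_le (E := (EuclideanSpace ℝ (Fin 3)))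
  set M' : ℝ := max M 0 with hM'_def
  have hM' : 0 ≤ M' := le_max_right _ _
  have hVb' : ∀ x, ‖V x‖ ≤ M' * ‖x‖ := fun x =>
    (hVb x).trans (mul_le_mul_of_nonneg_right (le_max_left _ _) (norm_nonneg _))
  have hzero : ∀ (R : ℝ), 0 < R → ∀ x : (EuclideanSpace ℝ (Fin 3)), ‖x‖ < R → fderiv ℝ (cutoff (E := (EuclideanSpace ℝ (Fin 3))) R) x = 0 := by
    intro R hR x hx
    have h : (cutoff (E := (EuclideanSpace ℝ (Fin 3))) R) =ᶠ[𝓝 x] fun _ => (1 : ℝ) := by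
      filter_upwards [Metric.isOpen_ball.mem_nhds (mem_ball_zero_iff.2 hx)] with y hy
      exact cutoff_eq_one hR (mem_ball_zero_iff.1 hy).le
    rw [h.fderiv_eq, fderiv_const_apply]
  have hzero' : ∀ (R : ℝ), 0 < R → ∀ x : (EuclideanSpace ℝ (Fin 3)), 2 * R < ‖x‖ → fderiv ℝ (cutoff (E := (EuclideanSpace ℝ (Fin 3))) R) x = 0 := by
    intro R hR x hx
    have h : (cutoff (E := (EuclideanSpace ℝ (Fin 3))) R) =ᶠ[𝓝 x] fun _ => (0 : ℝ) := by
      filter_upwards [(isOpen_lt continuous_const continuous_norm).mem_nhds hx] with y hy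
      exact cutoff_eq_zero hR (le_of_lt hy)
    rw [h.fderiv_eq, fderiv_const_apply]
  -- pointwise bound `|Dχ_R(x) (V x)| ≤ 2cM'`
  have hpt : ∀ (R : ℝ), 0 < R → ∀ x : (EuclideanSpace ℝ (Fin 3)), ‖fderiv ℝ (cutoff R) x (V x)‖ ≤ 2 * c * M' := by
    intro R hR x
    by_cases hx : 2 * R < ‖x‖
    · rw [hzero' R hR x hx]
      rw [show (0 : (EuclideanSpace ℝ (Fin 3)) →L[ℝ] ℝ) (V x) = 0 from rfl, norm_zero]; positivity
    · rw [not_lt] at hx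
      calc ‖fderiv ℝ (cutoff R) x (V x)‖ ≤ ‖fderiv ℝ (cutoff R) x‖ * ‖V x‖ :=
            ContinuousLinearMap.le_opNorm _ _
        _ ≤ c / R * (M' * (2 * R)) :=
            mul_le_mul (hc R hR x) ((hVb' x).trans (mul_le_mul_of_nonneg_left hx hM')) (norm_nonneg _)
              (div_nonneg hc0 hR.le)
        _ = 2 * c * M' := by field_simp
  have hmeas : ∀ n : ℕ, AEStronglyMeasurable
      (fun x => fderiv ℝ (cutoff ((n : ℝ) + 1)) x (V x) * ‖w x‖ ^ 2) (volume : Measure (EuclideanSpace ℝ (Fin 3))) := fun n =>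
    (((contDiff_cutoff (E := (EuclideanSpace ℝ (Fin 3))) (n := 1) ((n : ℝ) + 1)).continuous_fderiv one_ne_zero).clm_apply
      hV).aestronglyMeasurable.mul (hw.norm.pow 2).aestronglyMeasurable
  have h := tendsto_integral_of_dominated_convergence (μ := (volume : Measure (EuclideanSpace ℝ (Fin 3))))
    (F := fun (n : ℕ) x => fderiv ℝ (cutoff ((n : ℝ) + 1)) x (V x) * ‖w x‖ ^ 2) (f := fun _ => (0 : ℝ))
    (fun x => 2 * c * M' * ‖w x‖ ^ 2) hmeas (hw2.const_mul _) ?_ ?_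
  · simpa using h
  · intro n
    filter_upwards with x
    rw [norm_mul, norm_pow, norm_norm]
    exact mul_le_mul_of_nonneg_right (hpt _ (by positivity) x) (sq_nonneg _)
  · filter_upwards with x
    have hev : ∀ᶠ n : ℕ in atTop, fderiv ℝ (cutoff ((n : ℝ) + 1)) x (V x) * ‖w x‖ ^ 2 = 0 := by
      filter_upwards [eventually_gt_atTop ⌈‖x‖⌉₊] with n hn
      have hxn : ‖x‖ < (n : ℝ) + 1 :=
        ((Nat.le_ceil ‖x‖).trans_lt (by exact_mod_cast hn)).trans (lt_add_one _)
      rw [hzero _ (by positivity) x hxn, show (0 : (EuclideanSpace ℝ (Fin 3)) →L[ℝ] ℝ) (V x) = 0 from rfl, zero_mul]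
    exact tendsto_const_nhds.congr' (hev.mono fun n hn => hn.symm)

/-- `∫ |w|² Δχ_{n+1} → 0` when `|w|² ∈ L¹` (`|Δχ_R| ≤ C/R²`). [folklore] -/
theorem tendsto_integral_norm_sq_mul_laplacian_cutoff {w : (EuclideanSpace ℝ (Fin 3)) → (EuclideanSpace ℝ (Fin 3))} (hw2 : Integrable fun x => ‖w x‖ ^ 2) :
    Tendsto (fun n : ℕ => ∫ x, ‖w x‖ ^ 2 * (Δ (cutoff (E := (EuclideanSpace ℝ (Fin 3))) ((n : ℝ) + 1))) x) atTop (𝓝 0) := by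
  obtain ⟨C, hC0, hC⟩ := exists_abs_laplacian_cutoff_le (E := (EuclideanSpace ℝ (Fin 3)))
  refine tendsto_integral_zero_of_norm_le_mul hw2 (ε := fun n => C / ((n : ℝ) + 1) ^ 2) ?_ ?_
  · have h1 : Tendsto (fun n : ℕ => ((n : ℝ) + 1) ^ 2) atTop atTop :=
      (tendsto_pow_atTop two_ne_zero).comp
        (tendsto_natCast_atTop_atTop.atTop_add tendsto_const_nhds)
    exact tendsto_const_nhds.div_atTop h1
  · intro n x
    rw [norm_mul, norm_pow, norm_norm, mul_comm]
    exact mul_le_mul_of_nonneg_right (by rw [Real.norm_eq_abs]; exact hC _ (by positivity) x)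
      (sq_nonneg _)

end ProfileEnstrophyBalance

end MaximiserSetRigidity

end Summit.NavierStokesRegularity.NavierStokesRegularity.Theorems

end
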